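import Literature.AlgebraicGeometry.Modules.EpiOfFibrewiseSurjective
import Literature.AlgebraicGeometry.Modules.EpiOfSameRankIsIso
import Literature.AlgebraicGeometry.Modules.IsoOfSectionsOnBasis
import Literature.AlgebraicGeometry.Modules.PullbackAffineChart
import Literature.AlgebraicGeometry.AbelianVarieties.PoincareSheafOfPrincipal
import HarnessLib

/-!
# A line bundle is trivial as soon as a global section generates it after pull-back along a SURJECTIVE morphism
# (Nakayama for sheaves, [StacksProject, Tag 01B8]; [GortzWedhorn2020, Prop. 7.30]; [Matsumura1987, Thm. 2.4])

Layer `Literature/AlgebraicGeometry/Modules`, namespace `Literature.AlgebraicGeometry.Modules`.  THEOREMS ONLY (no definition, no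
named fact, no instance, no notation, no `sorry`).  Cell `hodgecm-mathlib` (D-0151), brick B5(b) of the «H1-DIM-ANY-CHAR cut» (B-p04 (g40) memo
`MEMO-H1DIM-cut.v1`, §2 B5: «a line bundle on `A × Z`, `Z` local artinian, with a section that generates on the closed fibre is trivial»),
stated in the generality the proof gives — for ANY surjective morphism `g : X ⟶ T` in place of the closed fibre `A × Spec κ ↪ A × Z`:

For `g : X ⟶ T` SURJECTIVE (on points), `E` an `𝒪_T`-module locally free of rank `r` (`HasRank E r`):

* §1 `epi_of_isUnit_app_top` — a morphism `χ : M ⟶ 𝒪_X` hitting a global UNIT is an epimorphism (it is surjective on every open: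
  `r = χ(r u⁻¹ · m)`).
* §2 **`isIso_of_hasRank_of_epi_pullback_map`** — a morphism `s : M ⟶ E` between modules of the SAME rank `r` whose pull-back `g^*s`
  is an epimorphism is an isomorphism: `g^*s` epi ⇒ `s` epi (★ `epi_of_epi_pullback_map_of_surjective_of_isFiniteLocallyFree`, Nakayama on
  the stalks through the LOCAL homomorphisms `𝒪_{T,g p} → 𝒪_{X,p}`, [StacksProject, Tag 01B8]) ⇒ `s` iso (★ `isIso_of_epi_of_hasRank`,
  [Matsumura1987, Thm. 2.4]).
* §3 **`isIso_of_isUnit_pullback_unitHom`** — for `s : 𝒪_T ⟶ E` with `E` of rank ONE and an isomorphism `φ : g^*E ≅ 𝒪_X` under which the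
  pulled-back section `η(s(1))` is a global unit, `s` is an isomorphism (`g^*s` followed by `φ` hits a unit, §1, so `g^*s` is epi, §2).
* §4 `exists_unitHom_app_top_eq` — every global section `σ ∈ Γ(T, E)` is `s(1)` for a (unique) `s : 𝒪_T ⟶ E`, `s(r) = r • σ|`; hence
  **`nonempty_iso_unitModule_of_isUnit_pullback_section`** — `E ≅ 𝒪_T` as soon as SOME global section `σ` of the rank-one `E` becomes,
  under some trivialisation `φ : g^*E ≅ 𝒪_X` of the pull-back, a global unit `φ(η(σ)) ∈ Γ(X, 𝒪_X)^×`.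

The consumer (B5 of the cut): `T = A × Spec (R∕J)` an infinitesimal neighbourhood of the closed fibre `X = A × Spec κ` of an abelian scheme,
`g` the (surjective) closed-fibre inclusion, `E = 𝒫|_T` the Poincaré candidate, `φ` its rigidification on the closed fibre, `σ` a lift of the
generator of `Γ(A, 𝒪_A) = κ` — then `𝒫|_T` is trivial and first-order rigidity (★ `firstOrderRigid_of_graphCond`) applies.
HC_CM is proved only modulo the 7 printed citations until rung 0 closes; nothing here bears on a summit statement (count-neutral capital).

## References
* [StacksProject] The Stacks Project, Tag 01B8 (Modules, Lemma 17.9.4: Nakayama's lemma for sheaves of modules), Tag 00WN.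
* [GortzWedhorn2020] U. Görtz, T. Wedhorn, *Algebraic Geometry I*, 2nd ed. (2020), Prop. 7.30 and (7.8.6).
* [Matsumura1987] H. Matsumura, *Commutative Ring Theory* (1986/1989), Theorem 2.4 (PDF p. 18).
* [Hartshorne1977] R. Hartshorne, *Algebraic Geometry* (1977), II.5 (p. 110) (`f^*`), II Prop. 5.6 (p. 113).
-/

set_option autoImplicit false

noncomputable section

universe u

open CategoryTheory CategoryTheory.Limits AlgebraicGeometry TopologicalSpace Opposite

namespace Literature.AlgebraicGeometry.Modules

open Literature.AlgebraicGeometry.Motives Literature.AlgebraicGeometry.AbelianVarieties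

/-! ## §1 A morphism to `𝒪_X` hitting a global unit is an epimorphism -/

section EpiUnit

variable {X : Scheme.{u}} {M : X.Modules}

/-- **A morphism `χ : M ⟶ 𝒪_X` whose value on some global section `m` is a UNIT of `Γ(X, 𝒪_X)` is an epimorphism**: it is
surjective on every open `V`, `r = χ_V((r · u⁻¹|_V) • m|_V)` for `u = χ_⊤(m)`.
[cite: StacksProject, Tag 00WN] [cite: Hartshorne1977, II.5 (p. 110)] -/
theorem epi_of_isUnit_app_top (χ : M ⟶ unitModule X) (m : Γ(M, ⊤)) (hu : IsUnit (M := Γ(X, ⊤)) (χ.app ⊤ m)) : Epi χ := by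
  obtain ⟨v, hv⟩ := hu.exists_right_inv
  refine epi_of_surjective_app_of_isAffineOpen χ fun V _ => fun r => ?_
  let k : V ⟶ ⊤ := homOfLE le_top
  refine ⟨((show Γ(X, V) from r) * X.presheaf.map k.op v) • M.presheaf.map k.op m, ?_⟩
  rw [Scheme.Modules.Hom.app_smul, Scheme.Modules.Hom.app_map_apply]
  change ((show Γ(X, V) from r) * X.presheaf.map k.op v) * X.presheaf.map k.op (show Γ(X, ⊤) from χ.app ⊤ m) = r
  rw [mul_assoc, ← map_mul, mul_comm v, hv, map_one, mul_one]

/-- The same for a morphism `χ : M ⟶ N` into a module `N` IDENTIFIED with `𝒪_X` by `ψ : N ≅ 𝒪_X`: if `ψ(χ(m))` is a global unit,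
`χ` is an epimorphism. [cite: StacksProject, Tag 00WN] -/
theorem epi_of_isUnit_app_top_iso {N : X.Modules} (χ : M ⟶ N) (ψ : N ≅ unitModule X) (m : Γ(M, ⊤))
    (hu : IsUnit (M := Γ(X, ⊤)) (ψ.hom.app ⊤ (χ.app ⊤ m))) : Epi χ := by
  haveI : Epi (χ ≫ ψ.hom) := by
    refine epi_of_isUnit_app_top (χ ≫ ψ.hom) m ?_
    have h : (χ ≫ ψ.hom).app ⊤ m = ψ.hom.app ⊤ (χ.app ⊤ m) := by
      rw [Scheme.Modules.Hom.comp_app]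
      rfl
    rw [h]
    exact hu
  haveI : Epi ((χ ≫ ψ.hom) ≫ ψ.inv) := epi_comp _ _
  simpa using (inferInstance : Epi ((χ ≫ ψ.hom) ≫ ψ.inv))

end EpiUnit

/-! ## §2 Pull-back along a surjective morphism reflects isomorphisms between bundles of the same rank -/

section SameRank

variable {X T : Scheme.{u}} (g : X ⟶ T) [Surjective g] {M E : T.Modules}

/-- **Pull-back along a SURJECTIVE morphism reflects isomorphisms between locally free modules of the same rank**: if `M`, `E` have
rank `r`, `s : M ⟶ E`, and `g^*s` is an epimorphism for some surjective `g : X ⟶ T`, then `s` is an isomorphism — `s` is an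
epimorphism by Nakayama on the stalks through the local homomorphisms `𝒪_{T,g(p)} → 𝒪_{X,p}` (★
`epi_of_epi_pullback_map_of_surjective_of_isFiniteLocallyFree`) and an epimorphism between bundles of the same rank is an isomorphism
(★ `isIso_of_epi_of_hasRank`).
[cite: StacksProject, Tag 01B8 (Lemma 17.9.4)] [cite: GortzWedhorn2020, Prop. 7.30 and (7.8.6)] [cite: Matsumura1987, Theorem 2.4 (PDF p. 18)] -/
theorem isIso_of_hasRank_of_epi_pullback_map (s : M ⟶ E) {r : ℕ} (hM : HasRank M r) (hE : HasRank E r)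
    [Epi ((Scheme.Modules.pullback g).map s)] : IsIso s := by
  haveI : Epi s := epi_of_epi_pullback_map_of_surjective_of_isFiniteLocallyFree s g (HasRank.isFiniteLocallyFree' hE)
  exact isIso_of_epi_of_hasRank s hM hE

/-- Rank-one case: a morphism `s : 𝒪_T ⟶ E` to a line bundle whose pull-back along a surjective `g` is an epimorphism is an
isomorphism. [cite: StacksProject, Tag 01B8 (Lemma 17.9.4)] [cite: Matsumura1987, Theorem 2.4 (PDF p. 18)] -/
theorem isIso_unitHom_of_epi_pullback_map (s : unitModule T ⟶ E) (hE : HasRank E 1) [Epi ((Scheme.Modules.pullback g).map s)] :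
    IsIso s :=
  isIso_of_hasRank_of_epi_pullback_map g s hasRank_unitModule hE

end SameRank

/-! ## §3 A morphism `𝒪_T ⟶ E` whose pulled-back generator becomes a unit under a trivialisation of `g^*E` is an isomorphism -/

section UnitHom

variable {X T : Scheme.{u}} (g : X ⟶ T) [Surjective g] {E : T.Modules}

omit [Surjective g] in
/-- The pull-back of `s : 𝒪_T ⟶ E` maps the pulled-back unit section `η(1)` to `η(s(1))`. [cite: Hartshorne1977, II.5 (p. 110)] -/
theorem pullback_map_app_unitSection_one (s : unitModule T ⟶ E) :
    ((Scheme.Modules.pullback g).map s).app (g ⁻¹ᵁ ⊤) (unitSection g (unitModule T) ⊤ (1 : Γ(T, ⊤))) =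
      unitSection g E ⊤ (s.app ⊤ (1 : Γ(T, ⊤))) :=
  pullback_map_app_unitSection g s ⊤ _

/-- **`s : 𝒪_T ⟶ E` is an isomorphism as soon as, for some surjective `g : X ⟶ T` and some isomorphism `φ : g^*E ≅ 𝒪_X`, the global
function `φ(η(s(1)))` is a unit** (`E` of rank one): `g^*s ≫ φ` hits a unit (§1) so `g^*s` is an epimorphism, and §2 applies.
[cite: StacksProject, Tag 01B8 (Lemma 17.9.4)] [cite: GortzWedhorn2020, Prop. 7.30 and (7.8.6)] [cite: Matsumura1987, Theorem 2.4 (PDF p. 18)] -/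
theorem isIso_of_isUnit_pullback_unitHom (s : unitModule T ⟶ E) (hE : HasRank E 1)
    (φ : (Scheme.Modules.pullback g).obj E ≅ unitModule X)
    (hu : IsUnit (M := Γ(X, ⊤)) (φ.hom.app ⊤ (unitSection g E ⊤ (s.app ⊤ (1 : Γ(T, ⊤)))))) : IsIso s := by
  haveI : Epi ((Scheme.Modules.pullback g).map s) := by
    refine epi_of_isUnit_app_top_iso ((Scheme.Modules.pullback g).map s) φ (unitSection g (unitModule T) ⊤ (1 : Γ(T, ⊤))) ?_
    have h := pullback_map_app_unitSection_one g s
    change ((Scheme.Modules.pullback g).map s).app ⊤ (unitSection g (unitModule T) ⊤ (1 : Γ(T, ⊤))) = _ at h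
    rw [h]
    exact hu
  exact isIso_unitHom_of_epi_pullback_map g s hE

end UnitHom

/-! ## §4 Section form: `E ≅ 𝒪_T` from a global section that becomes a unit after pull-back -/

section SectionForm

variable {X T : Scheme.{u}} {E : T.Modules}

/-- **Every global section `σ` is the value on `1` of a morphism `s : 𝒪_T ⟶ E`** with `s_V(r) = r • σ|_V` (Mathlib `unitHomEquiv`).
[cite: Hartshorne1977, II.5 (p. 110)] -/
theorem exists_unitHom_app_top_eq (σ : Γ(E, ⊤)) :
    ∃ s : unitModule T ⟶ E, s.app ⊤ (1 : Γ(T, ⊤)) = σ ∧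
      ∀ (V : T.Opens) (r : Γ(unitModule T, V)), s.app V r = (show Γ(T, V) from r) • E.presheaf.map (homOfLE (le_top : V ≤ ⊤)).op σ := by
  let sec : E.sections := PresheafOfModules.sectionsMk (M := E.val)
    (fun U => E.presheaf.map (homOfLE (le_top : U.unop ≤ ⊤)).op σ) fun U V i => by
      change (E.presheaf.map (homOfLE (le_top : U.unop ≤ ⊤)).op ≫ E.presheaf.map i) σ =
        E.presheaf.map (homOfLE (le_top : V.unop ≤ ⊤)).op σ
      rw [← Functor.map_comp]
      rfl
  refine ⟨E.unitHomEquiv.symm sec, ?_, fun V r => rfl⟩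
  change (1 : Γ(T, ⊤)) • E.presheaf.map (homOfLE (le_top : (⊤ : T.Opens) ≤ ⊤)).op σ = σ
  rw [one_smul]
  have h : (homOfLE (le_top : (⊤ : T.Opens) ≤ ⊤)).op = 𝟙 (op ⊤) := Subsingleton.elim _ _
  rw [h, E.presheaf.map_id]
  rfl

/-- **A LINE BUNDLE WITH A GLOBAL SECTION THAT GENERATES AFTER PULL-BACK ALONG A SURJECTIVE MORPHISM IS TRIVIAL.**  `E` of rank one on
`T`, `σ ∈ Γ(T, E)`, `g : X ⟶ T` surjective, `φ : g^*E ≅ 𝒪_X` a trivialisation of the pull-back under which `η(σ)` is a global UNIT; then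
`E ≅ 𝒪_T` (indeed `r ↦ r • σ` is an isomorphism `𝒪_T ⥲ E`, §3).  The case of the cut: `g` the closed fibre of an infinitesimal thickening
`A × Spec (R∕J)` of an abelian scheme `A × Spec κ` (a surjective closed immersion), `E` the Poincaré candidate, `φ` its rigidification.
[cite: StacksProject, Tag 01B8 (Lemma 17.9.4)] [cite: GortzWedhorn2020, Prop. 7.30 and (7.8.6)] [cite: Matsumura1987, Theorem 2.4 (PDF p. 18)] -/
theorem nonempty_iso_unitModule_of_isUnit_pullback_section (hE : HasRank E 1) (σ : Γ(E, ⊤)) (g : X ⟶ T) [Surjective g]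
    (φ : (Scheme.Modules.pullback g).obj E ≅ unitModule X)
    (hu : IsUnit (M := Γ(X, ⊤)) (φ.hom.app ⊤ (unitSection g E ⊤ σ))) : Nonempty (E ≅ unitModule T) := by
  obtain ⟨s, hs1, -⟩ := exists_unitHom_app_top_eq σ
  rw [← hs1] at hu
  haveI := isIso_of_isUnit_pullback_unitHom g s hE φ hu
  exact ⟨(asIso s).symm⟩

/-- The same with the isomorphism `𝒪_T ⥲ E` NORMALISED to send `1` to `σ`. [cite: StacksProject, Tag 01B8 (Lemma 17.9.4)] -/
theorem exists_iso_unitModule_app_one_eq_of_isUnit_pullback_section (hE : HasRank E 1) (σ : Γ(E, ⊤)) (g : X ⟶ T) [Surjective g]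
    (φ : (Scheme.Modules.pullback g).obj E ≅ unitModule X)
    (hu : IsUnit (M := Γ(X, ⊤)) (φ.hom.app ⊤ (unitSection g E ⊤ σ))) :
    ∃ e : unitModule T ≅ E, e.hom.app ⊤ (1 : Γ(T, ⊤)) = σ := by
  obtain ⟨s, hs1, -⟩ := exists_unitHom_app_top_eq σ
  have hu' := hu
  rw [← hs1] at hu'
  haveI := isIso_of_isUnit_pullback_unitHom g s hE φ hu'
  exact ⟨asIso s, hs1⟩

end SectionForm

end Literature.AlgebraicGeometry.Modules

end
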